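import Mathlib
import HarnessLib
import HarnessLib.Audit
import Summits.Parity.Statement
import Literature.NumberTheory.Sieve.SingularSeries

/-!
Route: ParityCorner

CLOSED (retired) 2026-08-15T13:50:16Z by operator:999:1257524 — reason: not-a-thesis: assembly does not conclude the sub-problem Statement — note: D-0027 §2.1 audit (human 2026-08-15: routes that do not decide the summit are removed): the assembly concludes `PairsHL`, not the sub-problem statement; a NEW conforming route may be opened from the same idea (generated `closes : … → _root_.GeneralizedHardyLittlewood`).. The file is kept as the record of this route; refuted decls are indexed as negative knowledge (`ledger negatives`).

# Route ParityCorner — Hardy–Littlewood pairs as the corner Taylor coefficient of the Jordan-totient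
deformation, forced by Vitali from half-disc bounds

X (ParityCorner; realises idea card Parity/GeneralizedHardyLittlewood/parity-corner-vitali).
Jordan-totient deformation:
J_z(n) := Σ_{d|n} μ(d)(n/d)^z = n^z Π_{p|n}(1 − p^{−z}) is the exponential generating function of
the generalised von Mangoldt
functions (Σ_k Λ_k(n) z^k/k! = J_z(n), Λ_k = μ∗log^k), so Λ = ∂_z J_z|_{z=0}, and for h ≥ 1 the
entire family
f_{x,h}(z) := x^{−1−2z} Σ_{n≤x} J_z(n)J_z(n+h) has Taylor coefficients 0, Λ(h+1)/x,
x^{−1}Σ_{n≤x}Λ(n)Λ(n+h) + O(log x·log h/x) at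
the CORNER z = 0. On the open half-plane Re z > 0 the asymptotic f_{x,h} → g_h is elementary
(TrivialRegion, provable), with
g_h(z) = (1+2z)^{−1} Σ_{gcd(d,e)|h} μ(d)μ(e) gcd(d,e)(de)^{−1−z} = ζ(1+z)^{−2}H_h(z)/(1+2z),
holomorphic on |z| < 1/2 with
g_h''(0)/2 = 𝔖({0,h}) (CornerContinuation, provable). It suffices to show X = LeftHalfDiscBound ∧
RightHalfDiscBound: for every
h ≥ 1 the family is UNIFORMLY BOUNDED on a closed half-disc {|z| ≤ ρ, Re z ≤ 0} and on a closed
half-disc {|z| ≤ ρ', Re z ≥ 0}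
(ρ, ρ' > 0 depending on h; together: bounded on the full disc of radius min(ρ,ρ'), i.e. the card's
H(ρ)). Then Vitali–Porter
(VitaliPorter, provable) forces f_{x,h} → g_h locally uniformly near 0 with all derivatives, and the
corner coefficient gives
Σ_{n≤N}Λ(n)Λ(n+h) = 𝔖({0,h})N + o(N) for every h (PairsHL, the target). The split Left/Right is by
PARITY CONTENT: the Liouville
reweighting n ↦ (1−λ(n)λ(n+h)) maps J_z(n) to n^z J_{−z}(n) on squarefrees, i.e. REFLECTS the disc z
↦ −z; boundedness on the right
half-disc is consistent with Selberg–Bombieri ghosts (a log-power saving, plausibly provable),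
boundedness on the left half-disc is
not (a power saving x^{2ρ} in a μ-signed binary sum: the parity step, supplied as a main-term-free
BOUND, never as an asymptotic).
Lean: `∀ h : ℕ, 1 ≤ h → ∃ ρ : ℝ, 0 < ρ ∧ ∃ M : ℝ, ∃ x₀ : ℕ, ∀ x : ℕ, x₀ ≤ x → ∀ z : ℂ, ‖z‖ ≤ ρ → ‖(x
: ℂ) ^ (-(1 : ℂ) - 2 * z) * ∑ n ∈ Finset.Icc 1 x, ((∑ d ∈ Nat.divisors n,
(ArithmeticFunction.moebius d : ℂ) * ((n / d : ℕ) : ℂ) ^ z) * (∑ e ∈ Nat.divisors (n + h),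
(ArithmeticFunction.moebius e : ℂ) * (((n + h) / e : ℕ) : ℂ) ^ z))‖ ≤ M`

## Assembly
Bookkeeping plus the three provable supports. Fix h ≥ 1; take ρ_L, M_L, x_L from LeftHalfDiscBound,
ρ_R, M_R, x_R from
RightHalfDiscBound, ρ₀, G from CornerContinuation; r := min(ρ_L, ρ_R, ρ₀), V := ball(0, r) (open,
convex hence preconnected),
U := V ∩ {Re z > 0} (open, nonempty), F_n(z) := f_{n+x₁,h}(z) with x₁ := max(x_L, x_R, 1) (entire:
finite sums of k^z, k ≥ 1, times
x^{−1−2z}); every compact K ⊆ V lies in both half-discs, so ‖F_n‖ ≤ max(M_L, M_R) on K;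
TrivialRegion gives F_n(z) → g_h(z) = G(z) for
z ∈ U; VitaliPorter ⟹ F_n → G locally uniformly on V ⟹ (TendstoLocallyUniformlyOn.deriv twice)
iteratedDeriv 2 F_n 0 → G''(0) =
2𝔖({0,h}); the identity iteratedDeriv 2 f_{x,h} 0 = (2/x)Σ_{n≤x}Λ(n)Λ(n+h) + (Λ₂(h+1) − 4 log
x·Λ(h+1))/x (from Σ_{d|n}μ(d) = [n=1],
Σ_{d|n}μ(d)log(n/d) = Λ(n), Λ₂ = μ∗log²) then gives x^{−1}Σ_{n≤x}Λ(n)Λ(n+h) → 𝔖({0,h}), i.e. PairsHL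
at h (real parts). From PairsHL to
the typed sub-problem Literature.NumberTheory.Sieve.GeneralizedHardyLittlewood one still needs
t-tuples and shift-uniformity |b_i| ≤ LN
(route DicksonFibration, DimOne → GHL): see Not decomposed yet.

Rationale: WHY THIS LINE. Mechanism: analytic continuation in the RANK variable z of the Λ_k-hierarchy (complex
function theory: normal families,
Vitali–Porter, identity theorem) converts a qualitative main-term-free BOUND on a disc into the
Hardy–Littlewood ASYMPTOTIC with
the right constant — the constant 𝔖({0,h}) is computed from ζ(1+z)^{−2} and never assumed, and no
major arc, level of distribution or
sieve identity is used (BombieriAsymptoticSieve1976: Type-I data fix Λ_k-sums for k ≥ 2 and leave k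
= 1 free — here k is
interpolated by z and the k = 1 corner is forced by analyticity from the trivial quadrant Re z > 0).
Sources: Tenenbaum2015 II.5
(Selberg–Delange: continuation in a complex exponent, one-point), arXiv:0807.4739 (mod-φ
convergence: complex-uniform bounds ⇒
fine asymptotics), Golomb1970 (Λ-calculus: Λ(n)Λ(n+h) = ½Λ₂(n(n+h)) = the z² coefficient of
J_z(n(n+h)), stuck at an Abel-variable
interchange), TaoFMP2016 / SawinShusterman2018 (what is and is not known for μ-signed binary sums
over ℤ / F_q[T]). Imported area:
complex analysis of holomorphic families; no probabilistic, spectral or physical reformulation is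
used. Relative to the existing
GHL routes: TauberianTwins continues in the SCALE variable s of Σ Λ(n)Λ(n+h)n^{−s} and must assume
the constant on log-average;
MobiusShiftedPrimes/QuadraticRoots assume EH-type distribution; this line assumes neither — its only
non-provable inputs are two
sup-norm bounds. It is the GHL-side sibling of route-Parity-SelbergDelange (BatemanHorn, z^{ω(n²+1)}
family): different deformation
(two-point J_z ⊗ J_z with an elementary open region Re z > 0, versus one-point z^ω with an LSD law
to be proved on Re z > 1), same
extraction principle. Negatives index: empty for Parity at filing.

RANKED CRUXES. #0 PairsHL (target) — Hardy–Littlewood pairs, Λ-form, fixed shift: for every h ≥ 1,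
Σ_{n≤N} Λ(n)Λ(n+h) = 𝔖({0,h}) N + o(N) (the d = 1, t = 2 fixed-shift content of GHL; verbatim the
target of route TauberianTwins, shared). X = LeftHalfDiscBound ∧ RightHalfDiscBound is what the
route adds; PairsHL is where its Assembly lands. (why it might fail: Binary HL (1923 Conj. B), fixed
even h: open, twin-prime strength; parity blocks sieve deductions even under EH
(Literature.Barriers.Parity.PrimePairParity); Siegel-sensitive only in its shift-uniform form.)
[HardyLittlewood1923, GreenTao2010, BombieriAsymptoticSieve1976]
#2 LeftHalfDiscBound (crux) — for every h ≥ 1 there are ρ > 0, M, x₀ with |x^{−1−2z} Σ_{n≤x}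
J_z(n)J_z(n+h)| ≤ M for all x ≥ x₀ and all z in the closed LEFT half-disc |z| ≤ ρ, Re z ≤ 0 (card
Crux 1 = H(ρ), left half: the parity content). At z = −ρ: |Σ_{n≤x}
μ(n)μ(n+h)a_ρ(n)a_ρ(n+h)·(non-squarefree corrections)| ≤ M x^{1−2ρ}, a_ρ(p) = 1 − p^{−ρ} — a power
saving x^{2ρ}, ρ > 0 as small as we like, with NO main term to identify. [difficulty: open-problem]
(why it might fail: At z=−ρ it is a power saving x^{2ρ} for a μ-signed binary correlation: none is
known over ℤ (o(x) only log-averaged, TaoFMP2016); Liouville reweighting maps it to x^{2ρ}·(right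
arc) so no Type-I proof exists; an extreme Siegel zero mod q makes f_x(−ρ)≈−c x^{2ρ}/q;
all-or-nothing in ρ.) [TaoFMP2016, SawinShusterman2018, BombieriAsymptoticSieve1976,
MatomakiMerikoski2023, Literature.Barriers.Parity.SelbergParityBarrier,
Literature.Barriers.Parity.SiegelZeroPrimePairBarrier]
#3 RightHalfDiscBound (crux) — for every h ≥ 1 there are ρ > 0, M, x₀ with |x^{−1−2z} Σ_{n≤x}
J_z(n)J_z(n+h)| ≤ M for all x ≥ x₀ and all z in the closed RIGHT half-disc |z| ≤ ρ, Re z ≥ 0 (card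
Crux 2: uniformity of the trivial region up to and on the imaginary axis). On Re z ≥ σ₀ > 0 it is
TrivialRegion; for |z| ≲ 1/log x it is Taylor bookkeeping plus Σ_{n≤x}Λ_a(n)Λ_b(n+h) ≪ x(log
x)^{a+b−2} (sieve upper bounds); the content is the axis z = it, 1/log x ≪ |t| ≤ ρ, where J_{it}(n)
= n^{it}Π_{p|n}(1 − p^{−it}) and a saving (|t| log x)^{0.55} over the Henriot/Nair–Tenenbaum mean of
|J_{it}(n)J_{it}(n+h)| is required. Ghost-consistent (the Liouville reweighting reflects it onto
itself), hence plausibly provable by Type-I/II means. [difficulty: L] (why it might fail: On z=it,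
1/log x≪|t|≤ρ, it needs a (|t|log x)^0.55 saving in Σ J_it(n)J_it(n+h): a binary correlation of the
UNBOUNDED multiplicative μ∗N^{it} at the abscissa where the Ingham–Mirsky (d,e)-expansion stops
converging; nothing such in print (Σ d_z(n)d_w(n+h) open for z,w∉ℕ).) [Henriot2012,
NairTenenbaum1998, Ingham1942, MatomakiRadziwillTao2019, Mangerel2018, Tenenbaum2015]
#4 AxisAsymptotic (crux) — for every h ≥ 1 and every fixed real t with 0 < |t| < 1/2: x^{−1−2it}
Σ_{n≤x} J_{it}(n)J_{it}(n+h) → g_h(it) = (1+2it)^{−1} ζ(1+it)^{−2} Π_p (1 − 2p^{−1−it} +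
[p|h]p^{−1−2it})(1 − p^{−1−it})^{−2} as x → ∞ (an Elliott-type binary asymptotic for the explicit
unbounded multiplicative functions J_{it}; the first PARITY-SENSITIVE point of the deformation at
o(1)-precision rather than power-saving precision; for |t| < min(ρ,ρ') it follows from X via the
Assembly, beyond that it is an independent probe). Not used by the Assembly. [difficulty:
open-problem] (why it might fail: Parity-sensitive already for fixed t: on squarefrees
λ(n)J_it(n)=n^{it}J_{−it}(n), so the weight 1−λ(n)λ(n+h) changes the limit at leading order ⇒ no
sieve/Type-I proof; an Elliott/Klurman-type asymptotic for UNBOUNDED multiplicative functions with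
1/ζ content — open even log-averaged.) [Elliott1992Correlations, KlurmanMangerelTeravainen2023,
TaoTeravainenDuke2019, MatomakiRadziwillTao2015, Literature.Barriers.Parity.PrimePairParity]
#9 TrivialRegion (support) — (K) PROVABLE NOW: for every h ≥ 1, f_{x,h}(z) =
x^{−1−2z}Σ_{n≤x}J_z(n)J_z(n+h) → g_h(z) := (1+2z)^{−1} Σ_{(d,e): gcd(d,e)|h} μ(d)μ(e)
gcd(d,e)(de)^{−1−z} locally uniformly on {Re z > 0} (the double series converges absolutely there).
Proof: truncate J_z(n) = n^z[Σ_{d|n, d≤y} μ(d)d^{−z} + O(τ(n)y^{−σ})], y = x^θ, θ < 1/2; the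
truncated double sum is a sum over n in progressions mod lcm(d,e) of n^z(n+h)^z (Euler–Maclaurin:
(gcd/de)·x^{1+2z}/(1+2z) + O(x^{2σ})); errors O(x^{−θσ}log³x + x^{2θ−1} + h/x) locally uniformly on
Re z ≥ σ > 0; Σ_{n≤x}τ(n)τ(n+h) ≪ x log²x. [difficulty: provable-now] [Ingham1942, Tenenbaum2015,
MontgomeryVaughan2007]
#9 CornerContinuation (support) — PROVABLE NOW: for every h ≥ 1 there are ρ₀ > 0 and G holomorphic
on |z| < ρ₀ with G = g_h on {|z| < ρ₀, Re z > 0} and G''(0) = 2·𝔖({0,h}). Proof: multiplicativity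
gives g_h(z)(1+2z) = Π_p(1 − 2p^{−1−z} + [p|h]p^{−1−2z}) = ζ(1+z)^{−2}·H_h(z), H_h(z) = Π_p(1 −
2p^{−1−z} + [p|h]p^{−1−2z})(1 − p^{−1−z})^{−2} absolutely convergent and holomorphic on Re z > −1/2;
z ↦ zζ(1+z) extends holomorphically and non-vanishing near 0 (riemannZeta_residue_one), so G(z) :=
z²(zζ(1+z))^{−2}H_h(z)/(1+2z) works with G''(0) = 2H_h(0); H_h(0) = Π_p (1 − ν_{{0,h}}(p)/p)(1 −
1/p)^{−2} = singularSeries {0,h} via tendsto_singularSeriesPartial_holds /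
hasProd_singularSeriesFactor_holds (for odd h the p = 2 factor vanishes, consistent). [difficulty:
provable-now] [Tenenbaum2015, HardyLittlewood1923, MontgomeryVaughan2007]
#9 VitaliPorter (support) — PROVABLE NOW (pure complex analysis): F_n holomorphic on an open
preconnected V, locally bounded on V (uniform bounds on compacta), converging pointwise on a
nonempty open U ⊆ V to Ψ holomorphic on V ⟹ F_n → Ψ locally uniformly on V. Proof: Cauchy estimates
⇒ local equicontinuity ⇒ Arzelà–Ascoli (BoundedContinuousFunction.arzela_ascoli) ⇒ every subsequence
has a locally uniformly convergent subsequence, whose limit is holomorphic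
(TendstoLocallyUniformlyOn.differentiableOn) and equals Ψ on U hence on V
(AnalyticOnNhd.eqOn_of_preconnected_of_eventuallyEq); so the whole sequence converges to Ψ locally
uniformly. Strengthens SelbergDelange.VitaliExtraction (stmt-Parity-0966: derivative at 0 only),
which follows from it by TendstoLocallyUniformlyOn.deriv. Mathlib has no Montel theorem yet: that is
the work. [difficulty: provable-now] [AhlforsCA1979, Conway1978, arXiv:0807.4739]
#9 PowerSavingCalibration (support) — PROVABLE NOW (calibration of the crux strength; the card's
kill test (b) in weak form, checked by the triage refuter): if for some h ≥ 1, ρ > 0, M, x₀ the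
family is bounded by M on the circle |z| = ρ for all x ≥ x₀, then Σ_{n≤N}Λ(n)Λ(n+h) = 𝔖({0,h})N +
O(N^{1−η}) for some η = η(ρ) > 0. Proof: shrink to ρ₁ = min(ρ, 1/4) (maximum principle); u_x =
log|f_{x,h} − G| is subharmonic on the disc, ≤ log(M + sup|G|) there and ≤ log(C x^{−θσ/2}) on the
small disc |z − ρ₁/2| ≤ ρ₁/4 (TrivialRegion with its rate); the two-constants theorem (or Hadamard
three-circles after a disc automorphism moving ρ₁/2 to 0) gives |f_{x,h} − G| ≤ C'x^{−c} on |z| =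
ρ₁/8, and Cauchy's estimate for the second derivative at 0 gives |x^{−1}Σ_{n≤x}Λ(n)Λ(n+h) − 𝔖| ≪
x^{−c} + log²x/x. Records that X is at least power-saving-HL strong (all-or-nothing). [difficulty:
M] [AhlforsCA1979, Tenenbaum2015, BombieriAsymptoticSieve1976]

TWO-LAYER PLAN. Foreseen glued splits (none filed now): RightHalfDiscBound ⇐ [SectorBound:
boundedness on {|z| ≤ ρ, |arg z| ≤ π/2 − δ} for every
δ > 0, i.e. TrivialRegion made uniform down to |z| ≍ 1/log x inside sectors — provable-looking] →
[AxisWindowBound: boundedness for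
z = it·e^{±iδ}, 1/log x ≤ |t| ≤ ρ] → RightHalfDiscBound. LeftHalfDiscBound ⇐ [LeftArcBound on |z| =
ρ, Re z ≤ 0] → [interior by the
maximum principle on the half-disc using RightHalfDiscBound on the diameter] → LeftHalfDiscBound (k
= 2). AxisAsymptotic ⇐
log-averaged version (entropy-decrement range) → almost-all-x version → AxisAsymptotic.

KILL CRITERIA. LeftHalfDiscBound REFUTED for some h (for every ρ > 0 the left half-disc sup is
unbounded in x) closes the route outright
(close --reason refuted:LeftHalfDiscBound): the deformation has no bounded corner neighbourhood and
Vitali cannot start; file the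
witness against power-saving-HL statements (by PowerSavingCalibration-type arguments it says the HL
error term is not O(x^{1−η}) in a
strong sense). RightHalfDiscBound refuted (unbounded on the axis for every ρ) also closes the route
and is news in itself (a
log-power LOSS in a ghost-consistent binary sum). AxisAsymptotic refuted at some fixed t pivots
nothing in the Assembly but kills the
card's heuristic that g_h is the limit beyond Re z > 0 — PIVOT: re-derive the limit object (the
Vitali frame survives with any
holomorphic limit whose z² coefficient is 𝔖). TrivialRegion / CornerContinuation / VitaliPorter
refuted ⇒ bookkeeping error ⇒ re-file
(my computations: g_h's Euler factor 1 − 2p^{−1−z} + [p|h]p^{−1−2z}; g_h''(0)/2 =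
Π_{p|h}(1−1/p)^{−1}Π_{p∤h}(1−2/p)(1−1/p)^{−2} =
𝔖({0,h})). PairsHL proved elsewhere moots the route; DimOne/GHL refuted upstream (Siegel-type) does
not touch the fixed-h items.

NOT DECOMPOSED YET. (i) The t-tuple, shift-uniform version needed for DicksonFibration.DimOne → GHL:
family x^{−1−tz}Σ_{n≤x}Π_i J_z(a_i n + b_i), bounds
uniform in |b_i| ≤ Lx, plus a quantitative Vitali (two-constants) for uniformity of the limit in the
shifts — inherits the
Siegel-zero sensitivity of the typed GHL (Literature.Barriers.Parity.SiegelZeroPrimePairBarrier) and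
is deliberately left until
PairsHL-level items move. (ii) The two-variable family x^{−1−z−w}ΣJ_z(n)J_w(n+h) (all Λ_k ⊗ Λ_l
correlations; Hartogs/Vitali in
two variables). (iii) Any attack on LeftHalfDiscBound itself (bilinear/dispersion structure of Σ
J_z(n)J_z(n+h) at Re z < 0;
transfer from F_q[T] where power-saving Chowla is a theorem, SawinShusterman2018). (iv) Numerics
(card falsifier (a)): kit table
of sup_{|z|=ρ}|f_{x,2}(z)| for x ≤ 10^9, ρ ∈ {0.05, 0.1, 0.2} — not run in this one-shot planning
unit; left to the refuter.

CHEAPEST FALSIFIER. (1) kit numerics: for h = 2 and x = 10^6 … 10^9 tabulate sup over 64 points of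
|z| = ρ (ρ = 0.05, 0.1, 0.2) of |f_{x,2}(z)|, and
f_{x,2}''(0)/2 against 2C₂ ≈ 1.3203; visible growth x^c on the LEFT arc at small ρ refutes
LeftHalfDiscBound empirically, growth
like (log x)^{0.5} on the axis points at RightHalfDiscBound. (2) Lookup: is a bound
Σ_{n≤x}F(n)G(n+h) ≪ x for the specific
pretentious-but-unbounded F = G = Π_{p|n}(1 − p^{−it}) already in print (Klurman 2017 Compositio
arXiv:1603.08453; Mangerel2018;
KlurmanMangerelTeravainen2023; Drappeau–Topacogullari 2019)? If yes, RightHalfDiscBound drops to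
support and the route is one
crux + AxisAsymptotic (still ≥ 2). (3) Paper check of the reflection identity λ(n)J_z(n) = n^z
J_{−z}(n) (squarefree n) that
underlies the Left/Right split — done here by hand.

NUMBERS. 𝔖({0,2}) = 2C₂ = 1.3203236… (Literature.NumberTheory.Sieve.singularSeries_pair_holds);
nearest zero of ζ(1+z) at |z| ≈ 14.13, so
g_h is holomorphic on |z| < 1/2 (pole of (1+2z)^{−1} at −1/2; H_h converges on Re z > −1/2);
random-model noise x^{1/2} at z = −ρ
predicts H(ρ) only for ρ < 1/4, hence every statement is '∃ ρ > 0'; trivial axis bound: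
Σ_{n≤x}|J_{it}(n)J_{it}(n+h)| ≍
x·t²(|t|log x)^{2(4/π−1)} = x·t²(|t|log x)^{0.546} (mean of 2|sin(t log p/2)| over large p is 4/π);
TrivialRegion rate
O(x^{−θσ}log³x + x^{2θ−1}) on Re z ≥ σ, θ < 1/2. Items at open: 9 (1 target, 3 cruxes, 4 supports, 1
assembly).

DEFINITION REQUESTS. None. J_z and f_{x,h} are inlined in every signature (route files carry no
helper defs); if a Literature home is wanted later:
notion `jordanTotientC (z : ℂ) (n : ℕ) : ℂ := ∑ d ∈ n.divisors, μ d * (n/d)^z` under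
Literature/NumberTheory (not filed: it would
block elaboration of the route until it lands).

Novelty: Searches (2026-08-15, this unit): `lit search --hybrid` ×4 ("Vitali theorem locally bounded family
analytic continuation of
asymptotic formula in a complex parameter", "Golomb lambda method prime constellations formal
identity von Mangoldt", "shifted
convolution sums multiplicative functions Mirsky Ingham asymptotic close to one", "correlations of
divisor functions complex powers
additive divisor problem d_z": 8 rows each, textbooks only, nothing on rank deformations); plain
`lit search` / zbMATH tier: searchd
connection reset / 0 rows all session (recorded); `lit galaxy search --star all` ×3 ("Jordan totient
function shifted convolution",
"Vitali theorem Hardy-Littlewood prime pairs analytic continuation in the parameter", "generalized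
von Mangoldt function Lambda_k
exponential generating function": 0 rows, pdf star saturated once); `lit frontier Parity --since
2020` (21 rows, none on
deformations in the rank of Λ_k or normal families); `lit bridges Parity --cross any` (30 rows, none
relevant); ledger: idea list
(86 GHL cards; nearest: fractional-von-mangoldt-boundary-layer = real-order one-factor deformation
under EH, graded variant;
divisor-power-surface-lsd2 retired), route-Parity-SelbergDelange read in full. Plus the card's own
audit (refuter-triage 2026-08-15):
Golomb1970 (doi:10.1016/0022-314x(70)90019-3), Hindry–Rivoal 2005 (zbl:1180.11032), Pontes thesis
2012
(doi:10.11606/d.45.2012.tde-25072012-204437, Thm 5.8: Λ(n)Λ(n+h) = ½Λ₂(n(n+h)), stuck at one limit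
interchang  [refs: 10.1016/0022-314x(70, 10.11606/d.45.2012.tde-25072012-204437, 0807.4739, doi:10.1016/0022-314x, doi:10.11606/d.45.2012.tde-25072012-204437, Golomb1970, Tenenbaum2015, BombieriAsymptoticSieve1976]

Barriers (technique_class: continuation-in-rank normal-families jordan-deformation): - technique_class: continuation-in-rank normal-families jordan-deformation
- Literature.Barriers.Parity.SelbergParityBarrier: APPLIES to LeftHalfDiscBound and is not evaded
there — the reweighting 1 ± λ(n)λ(n+h) sends f_{x,h}(z) to ≍ x^{−2Re z}·f_{x,h}(−z), unbounded on Re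
z < 0, so no Type-I argument proves the left bound (that is where the non-sieve input must enter, as
a BOUND); it does NOT apply to RightHalfDiscBound (reflection-invariant in size) nor to the
deduction TrivialRegion + X ⟹ PairsHL, which is complex-analytic, not a sieve identity.
- Literature.Barriers.Parity.PrimePairParity: the weight-insertion test is passed honestly —
inserting 1 − λ(n)λ(n+h) destroys LeftHalfDiscBound (hypothesis fails for the ghost), so the
deduction is not 'sieve-theoretic' in the barrier's sense; conceded that this makes
LeftHalfDiscBound parity-complete.
- Literature.Barriers.Parity.FordFixedLevelBarrier: no level of distribution anywhere (TrivialRegion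
is absolutely convergent bookkeeping with moduli ≤ x^{2θ}, θ < 1/2); the barrier correctly predicts
TrivialRegion cannot be pushed to Re z = 0 by distribution alone — that is RightHalfDiscBound's
content.
- Literature.Barriers.Parity.FordMaynardMinimalTypeII: consistent — LeftHalfDiscBound is
Type-II-strength (cancellation in μ-signed bilinear sums), supplied as a hypothesis, not
circumvented.
- Literature.Barriers.Parity.LogarithmicAveraging: Cesàro sums throughout; a log-averaged
AxisAsymptotic is only a foreseen layer-2 child, nev

Novelty grade: new-combination — route-review grade (refuter). Mechanism = two-point rank deformation J_z = μ∗N^z (EGF of Λ_k, classical identity) of the pair correlation + normal-families/Vitali extraction of the z² corner coefficient from a main-term-free disc bound. Nearest prior art actually located: Golomb 1970 (same Λ₂ corner (refuter refuter-rreview-route-Parity-ParityCorne-53200b5b-0, 2026-08-15T13:52:39Z; prior: Golomb1970 doi:10.1016/0022-314x(70)90019-3 (lambda method: Λ(n)Λ(n+h)=½Λ₂(n(n+h)), stuck at a limit interchange), BombieriAsymptoticSieve1976 (Λ_k hierarchy; Type-I data fix k≥2, leave k=1), Tenenbaum2015 II.5 Selberg–Delange (continuation in a complex exponent, one-point), arXiv:0807.4739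 (mod-φ convergence: complex-uniform bounds ⇒ asymptotics), route-Parity-SelbergDelange (BatemanHorn sibling:)

History (route lifecycle, newest last):
- 2026-08-15T13:50:16Z · CLOSED retired — not-a-thesis: assembly does not conclude the sub-problem Statement (operator:999:1257524)

sub-problem: GeneralizedHardyLittlewood · status: closed(retired) · opened planner-plancard-Parity-GeneralizedHardyLittl-56d27232-0 2026-08-15T11:19:34Z · rev 0 · ledger route-Parity-ParityCorner
GENERATED by the gate from the ledger (D-0016/17). Provers cite these decls: `theorem foo : Summit.Parity.GeneralizedHardyLittlewood.Theses.ParityCorner.<Decl> := …` in Summits/Parity/GeneralizedHardyLittlewood/Theorems/<Name>.lean.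
-/

namespace Summit.Parity.GeneralizedHardyLittlewood.Theses.ParityCorner

open scoped BigOperators Topology Manifold Classical MeasureTheory ProbabilityTheory Matrix InnerProductSpace ComplexConjugate ContinuousMap
open Filter Set Function TopologicalSpace MeasureTheory

attribute [summit_statement] _root_.GeneralizedHardyLittlewood

/-- item stmt-Parity-0867 · target · rank 0 · closed · moot by None · by planner
why it might fail: Binary HL (1923 Conj. B), fixed even h: open, twin-prime strength; parity blocks sieve deductions even under EH (Literature.Barriers.Parity.PrimePairParity); Siegel-sensitive only in its shift-uniform form.
sources: HardyLittlewood1923, GreenTao2010, BombieriAsymptoticSieve1976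
[target] Hardy–Littlewood pairs, Λ-form, fixed shift: for every h ≥ 1, ∑_{n ≤ N} Λ(n)Λ(n+h) =
𝔖({0,h}) N + o(N). The d = 1, t = 2, fixed-shift content of GHL (uniformity in h ≤ L N is NOT
claimed here; see route DicksonFibration). Open. [HardyLittlewood1923] [GreenTao2010, Example 1] -/
@[route_item "route-Parity-ParityCorner"]
def PairsHL : Prop :=
  ∀ h : ℕ, 1 ≤ h → (fun N : ℕ => ∑ n ∈ Finset.Icc 1 N, ArithmeticFunction.vonMangoldt n * ArithmeticFunction.vonMangoldt (n + h) - Literature.NumberTheory.Sieve.singularSeries ({0, (h : ℤ)} : Finset ℤ) * N) =o[Filter.atTop] fun N : ℕ => (N : ℝ)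

/-- item stmt-Parity-3531 · crux · rank 2 · closed · moot by None · by planner
why it might fail: At z=−ρ it is a power saving x^{2ρ} for a μ-signed binary correlation: none is known over ℤ (o(x) only log-averaged, TaoFMP2016); Liouville reweighting maps it to x^{2ρ}·(right arc) so no Type-I proof exists; an extreme Siegel zero mod q makes f_x(−ρ)≈−c x^{2ρ}/q; all-or-nothing in ρ.
sources: TaoFMP2016, SawinShusterman2018, BombieriAsymptoticSieve1976, MatomakiMerikoski2023, Literature.Barriers.Parity.SelbergParityBarrier, Literature.Barriers.Parity.SiegelZeroPrimePairBarrier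
[crux] for every h ≥ 1 there are ρ > 0, M, x₀ with |x^{−1−2z} Σ_{n≤x} J_z(n)J_z(n+h)| ≤ M for all x
≥ x₀ and all z in the closed LEFT half-disc |z| ≤ ρ, Re z ≤ 0 (card Crux 1 = H(ρ), left half: the
parity content). At z = −ρ: |Σ_{n≤x} μ(n)μ(n+h)a_ρ(n)a_ρ(n+h)·(non-squarefree corrections)| ≤ M
x^{1−2ρ}, a_ρ(p) = 1 − p^{−ρ} — a power saving x^{2ρ}, ρ > 0 as small as we like, with NO main term
to identify. [difficulty: open-problem] -/
@[route_item "route-Parity-ParityCorner"]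
def LeftHalfDiscBound : Prop :=
  ∀ h : ℕ, 1 ≤ h → ∃ ρ : ℝ, 0 < ρ ∧ ∃ M : ℝ, ∃ x₀ : ℕ, ∀ x : ℕ, x₀ ≤ x → ∀ z : ℂ, ‖z‖ ≤ ρ → z.re ≤ 0 → ‖(x : ℂ) ^ (-(1 : ℂ) - 2 * z) * ∑ n ∈ Finset.Icc 1 x, ((∑ d ∈ Nat.divisors n, (ArithmeticFunction.moebius d : ℂ) * ((n / d : ℕ) : ℂ) ^ z) * (∑ e ∈ Nat.divisors (n + h), (ArithmeticFunction.moebius e : ℂ) * (((n + h) / e : ℕ) : ℂ) ^ z))‖ ≤ M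

/-- item stmt-Parity-3532 · crux · rank 3 · closed · moot by None · by planner
why it might fail: On z=it, 1/log x≪|t|≤ρ, it needs a (|t|log x)^0.55 saving in Σ J_it(n)J_it(n+h): a binary correlation of the UNBOUNDED multiplicative μ∗N^{it} at the abscissa where the Ingham–Mirsky (d,e)-expansion stops converging; nothing such in print (Σ d_z(n)d_w(n+h) open for z,w∉ℕ).
sources: Henriot2012, NairTenenbaum1998, Ingham1942, MatomakiRadziwillTao2019, Mangerel2018, Tenenbaum2015
[crux] for every h ≥ 1 there are ρ > 0, M, x₀ with |x^{−1−2z} Σ_{n≤x} J_z(n)J_z(n+h)| ≤ M for all x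
≥ x₀ and all z in the closed RIGHT half-disc |z| ≤ ρ, Re z ≥ 0 (card Crux 2: uniformity of the
trivial region up to and on the imaginary axis). On Re z ≥ σ₀ > 0 it is TrivialRegion; for |z| ≲
1/log x it is Taylor bookkeeping plus Σ_{n≤x}Λ_a(n)Λ_b(n+h) ≪ x(log x)^{a+b−2} (sieve upper bounds);
the content is the axis z = it, 1/log x ≪ |t| ≤ ρ, where J_{it}(n) = n^{it}Π_{p|n}(1 − p^{−it}) and
a saving (|t| log x)^{0.55} over the Henriot/Nair–Tenenbaum mean of |J_{it}(n)J_{it}(n+h)| is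
required. Ghost-consistent (the Liouville reweighting reflects it onto itself), hence plausibly
provable by Type-I/II means. [difficulty: L] -/
@[route_item "route-Parity-ParityCorner"]
def RightHalfDiscBound : Prop :=
  ∀ h : ℕ, 1 ≤ h → ∃ ρ : ℝ, 0 < ρ ∧ ∃ M : ℝ, ∃ x₀ : ℕ, ∀ x : ℕ, x₀ ≤ x → ∀ z : ℂ, ‖z‖ ≤ ρ → 0 ≤ z.re → ‖(x : ℂ) ^ (-(1 : ℂ) - 2 * z) * ∑ n ∈ Finset.Icc 1 x, ((∑ d ∈ Nat.divisors n, (ArithmeticFunction.moebius d : ℂ) * ((n / d : ℕ) : ℂ) ^ z) * (∑ e ∈ Nat.divisors (n + h), (ArithmeticFunction.moebius e : ℂ) * (((n + h) / e : ℕ) : ℂ) ^ z))‖ ≤ M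

/-- item stmt-Parity-3533 · crux · rank 4 · closed · moot by None · by planner
why it might fail: Parity-sensitive already for fixed t: on squarefrees λ(n)J_it(n)=n^{it}J_{−it}(n), so the weight 1−λ(n)λ(n+h) changes the limit at leading order ⇒ no sieve/Type-I proof; an Elliott/Klurman-type asymptotic for UNBOUNDED multiplicative functions with 1/ζ content — open even log-averaged.
sources: Elliott1992Correlations, KlurmanMangerelTeravainen2023, TaoTeravainenDuke2019, MatomakiRadziwillTao2015, Literature.Barriers.Parity.PrimePairParity
[crux] for every h ≥ 1 and every fixed real t with 0 < |t| < 1/2: x^{−1−2it} Σ_{n≤x}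
J_{it}(n)J_{it}(n+h) → g_h(it) = (1+2it)^{−1} ζ(1+it)^{−2} Π_p (1 − 2p^{−1−it} + [p|h]p^{−1−2it})(1
− p^{−1−it})^{−2} as x → ∞ (an Elliott-type binary asymptotic for the explicit unbounded
multiplicative functions J_{it}; the first PARITY-SENSITIVE point of the deformation at
o(1)-precision rather than power-saving precision; for |t| < min(ρ,ρ') it follows from X via the
Assembly, beyond that it is an independent probe). Not used by the Assembly. [difficulty:
open-problem] -/
@[route_item "route-Parity-ParityCorner"]
def AxisAsymptotic : Prop :=
  ∀ h : ℕ, 1 ≤ h → ∀ t : ℝ, t ≠ 0 → |t| < 1 / 2 → Filter.Tendsto (fun x : ℕ => (x : ℂ) ^ (-(1 : ℂ) - 2 * ((t : ℂ) * Complex.I)) * ∑ n ∈ Finset.Icc 1 x, ((∑ d ∈ Nat.divisors n, (ArithmeticFunction.moebius d : ℂ) * ((n / d : ℕ) : ℂ) ^ ((t : ℂ) * Complex.I)) * (∑ e ∈ Nat.divisors (n + h), (ArithmeticFunction.moebius e : ℂ) * (((n + h) / e : ℕ) : ℂ) ^ ((t : ℂ) * Complex.I)))) Filter.atTop (nhds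 ((1 + 2 * ((t : ℂ) * Complex.I))⁻¹ * (riemannZeta (1 + (t : ℂ) * Complex.I))⁻¹ ^ 2 * ∏' p : Nat.Primes, ((1 - 2 * ((p : ℕ) : ℂ) ^ (-(1 : ℂ) - (t : ℂ) * Complex.I) + (if (p : ℕ) ∣ h then ((p : ℕ) : ℂ) ^ (-(1 : ℂ) - 2 * ((t : ℂ) * Complex.I)) else 0)) / (1 - ((p : ℕ) : ℂ) ^ (-(1 : ℂ) - (t : ℂ) * Complex.I)) ^ 2)))

/-- item stmt-Parity-3534 · support · rank 9 · closed · moot by None · by planner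
sources: Ingham1942, Tenenbaum2015, MontgomeryVaughan2007
[support] (K) PROVABLE NOW: for every h ≥ 1, f_{x,h}(z) = x^{−1−2z}Σ_{n≤x}J_z(n)J_z(n+h) → g_h(z) :=
(1+2z)^{−1} Σ_{(d,e): gcd(d,e)|h} μ(d)μ(e) gcd(d,e)(de)^{−1−z} locally uniformly on {Re z > 0} (the
double series converges absolutely there). Proof: truncate J_z(n) = n^z[Σ_{d|n, d≤y} μ(d)d^{−z} +
O(τ(n)y^{−σ})], y = x^θ, θ < 1/2; the truncated double sum is a sum over n in progressions mod
lcm(d,e) of n^z(n+h)^z (Euler–Maclaurin: (gcd/de)·x^{1+2z}/(1+2z) + O(x^{2σ})); errors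
O(x^{−θσ}log³x + x^{2θ−1} + h/x) locally uniformly on Re z ≥ σ > 0; Σ_{n≤x}τ(n)τ(n+h) ≪ x log²x.
[difficulty: provable-now] -/
@[route_item "route-Parity-ParityCorner"]
def TrivialRegion : Prop :=
  ∀ h : ℕ, 1 ≤ h → TendstoLocallyUniformlyOn (fun (x : ℕ) (z : ℂ) => (x : ℂ) ^ (-(1 : ℂ) - 2 * z) * ∑ n ∈ Finset.Icc 1 x, ((∑ d ∈ Nat.divisors n, (ArithmeticFunction.moebius d : ℂ) * ((n / d : ℕ) : ℂ) ^ z) * (∑ e ∈ Nat.divisors (n + h), (ArithmeticFunction.moebius e : ℂ) * (((n + h) / e : ℕ) : ℂ) ^ z))) (fun z : ℂ => (1 + 2 * z)⁻¹ * ∑' de : ℕ × ℕ, (if Nat.gcd de.1 de.2 ∣ h then (ArithmeticFunction.moebius de.1 : ℂ) * (ArithmeticFunction.moebius de.2 : ℂ) * (Nat.gcd de.1 de.2 : ℂ) * ((de.1 * de.2 : ℕ) : ℂ) ^ (-(1 : ℂ) - z) else 0)) Filter.atTop {z : ℂ | 0 < z.re}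

/-- item stmt-Parity-3535 · support · rank 9 · closed · moot by None · by planner
sources: Tenenbaum2015, HardyLittlewood1923, MontgomeryVaughan2007
[support] PROVABLE NOW: for every h ≥ 1 there are ρ₀ > 0 and G holomorphic on |z| < ρ₀ with G = g_h
on {|z| < ρ₀, Re z > 0} and G''(0) = 2·𝔖({0,h}). Proof: multiplicativity gives g_h(z)(1+2z) = Π_p(1
− 2p^{−1−z} + [p|h]p^{−1−2z}) = ζ(1+z)^{−2}·H_h(z), H_h(z) = Π_p(1 − 2p^{−1−z} + [p|h]p^{−1−2z})(1 −
p^{−1−z})^{−2} absolutely convergent and holomorphic on Re z > −1/2; z ↦ zζ(1+z) extends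
holomorphically and non-vanishing near 0 (riemannZeta_residue_one), so G(z) :=
z²(zζ(1+z))^{−2}H_h(z)/(1+2z) works with G''(0) = 2H_h(0); H_h(0) = Π_p (1 − ν_{{0,h}}(p)/p)(1 −
1/p)^{−2} = singularSeries {0,h} via tendsto_singularSeriesPartial_holds /
hasProd_singularSeriesFactor_holds (for odd h the p = 2 factor vanishes, consistent). [difficulty:
provable-now] -/
@[route_item "route-Parity-ParityCorner"]
def CornerContinuation : Prop :=
  ∀ h : ℕ, 1 ≤ h → ∃ ρ₀ : ℝ, 0 < ρ₀ ∧ ∃ G : ℂ → ℂ, DifferentiableOn ℂ G (Metric.ball 0 ρ₀) ∧ (∀ z ∈ Metric.ball (0 : ℂ) ρ₀, 0 < z.re → G z = (1 + 2 * z)⁻¹ * ∑' de : ℕ × ℕ, (if Nat.gcd de.1 de.2 ∣ h then (ArithmeticFunction.moebius de.1 : ℂ) * (ArithmeticFunction.moebius de.2 : ℂ) * (Nat.gcd de.1 de.2 : ℂ) * ((de.1 * de.2 : ℕ) : ℂ) ^ (-(1 : ℂ) - z) else 0)) ∧ iteratedDeriv 2 G 0 = 2 * (Literature.NumberTheory.Sieve.singularSeries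 ({0, (h : ℤ)} : Finset ℤ) : ℂ)

/-- item stmt-Parity-3536 · support · rank 9 · closed · moot by None · by planner
sources: AhlforsCA1979, Conway1978, arXiv:0807.4739
[support] PROVABLE NOW (pure complex analysis): F_n holomorphic on an open preconnected V, locally
bounded on V (uniform bounds on compacta), converging pointwise on a nonempty open U ⊆ V to Ψ
holomorphic on V ⟹ F_n → Ψ locally uniformly on V. Proof: Cauchy estimates ⇒ local equicontinuity ⇒
Arzelà–Ascoli (BoundedContinuousFunction.arzela_ascoli) ⇒ every subsequence has a locally uniformly
convergent subsequence, whose limit is holomorphic (TendstoLocallyUniformlyOn.differentiableOn) and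
equals Ψ on U hence on V (AnalyticOnNhd.eqOn_of_preconnected_of_eventuallyEq); so the whole sequence
converges to Ψ locally uniformly. Strengthens SelbergDelange.VitaliExtraction (stmt-Parity-0966:
derivative at 0 only), which follows from it by TendstoLocallyUniformlyOn.deriv. Mathlib has no
Montel theorem yet: that is the work. [difficulty: provable-now] -/
@[route_item "route-Parity-ParityCorner"]
def VitaliPorter : Prop :=
  ∀ (F : ℕ → ℂ → ℂ) (Ψ : ℂ → ℂ) (V U : Set ℂ), IsOpen V → IsPreconnected V → IsOpen U → U.Nonempty → U ⊆ V → (∀ n, DifferentiableOn ℂ (F n) V) → DifferentiableOn ℂ Ψ V → (∀ K ⊆ V, IsCompact K → ∃ C : ℝ, ∀ n, ∀ z ∈ K, ‖F n z‖ ≤ C) → (∀ z ∈ U, Filter.Tendsto (fun n => F n z) Filter.atTop (nhds (Ψ z))) → TendstoLocallyUniformlyOn F Ψ Filter.atTop V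

/-- item stmt-Parity-3537 · support · rank 9 · closed · moot by None · by planner
sources: AhlforsCA1979, Tenenbaum2015, BombieriAsymptoticSieve1976
[support] PROVABLE NOW (calibration of the crux strength; the card's kill test (b) in weak form,
checked by the triage refuter): if for some h ≥ 1, ρ > 0, M, x₀ the family is bounded by M on the
circle |z| = ρ for all x ≥ x₀, then Σ_{n≤N}Λ(n)Λ(n+h) = 𝔖({0,h})N + O(N^{1−η}) for some η = η(ρ) >
0. Proof: shrink to ρ₁ = min(ρ, 1/4) (maximum principle); u_x = log|f_{x,h} − G| is subharmonic on
the disc, ≤ log(M + sup|G|) there and ≤ log(C x^{−θσ/2}) on the small disc |z − ρ₁/2| ≤ ρ₁/4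
(TrivialRegion with its rate); the two-constants theorem (or Hadamard three-circles after a disc
automorphism moving ρ₁/2 to 0) gives |f_{x,h} − G| ≤ C'x^{−c} on |z| = ρ₁/8, and Cauchy's estimate
for the second derivative at 0 gives |x^{−1}Σ_{n≤x}Λ(n)Λ(n+h) − 𝔖| ≪ x^{−c} + log²x/x. Records that
X is at least power-saving-HL strong (all-or-nothing). [difficulty: M] -/
@[route_item "route-Parity-ParityCorner"]
def PowerSavingCalibration : Prop :=
  ∀ h : ℕ, 1 ≤ h → ∀ (ρ M : ℝ) (x₀ : ℕ), 0 < ρ → (∀ x : ℕ, x₀ ≤ x → ∀ z : ℂ, ‖z‖ = ρ → ‖(x : ℂ) ^ (-(1 : ℂ) - 2 * z) * ∑ n ∈ Finset.Icc 1 x, ((∑ d ∈ Nat.divisors n, (ArithmeticFunction.moebius d : ℂ) * ((n / d : ℕ) : ℂ) ^ z) * (∑ e ∈ Nat.divisors (n + h), (ArithmeticFunction.moebius e : ℂ) * (((n + h) / e : ℕ) : ℂ) ^ z))‖ ≤ M) → ∃ η : ℝ, 0 < η ∧ ∃ C : ℝ, ∀ N : ℕ, 2 ≤ N → |∑ n ∈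 Finset.Icc 1 N, ArithmeticFunction.vonMangoldt n * ArithmeticFunction.vonMangoldt (n + h) - Literature.NumberTheory.Sieve.singularSeries ({0, (h : ℤ)} : Finset ℤ) * N| ≤ C * (N : ℝ) ^ (1 - η)

/-- item stmt-Parity-3538 · assembly · rank 1 · closed · moot by None · by planner
sources: Tenenbaum2015, arXiv:0807.4739, GreenTao2010
[assembly] LeftHalfDiscBound → RightHalfDiscBound → TrivialRegion → CornerContinuation →
VitaliPorter → PairsHL (provable bookkeeping as above; the three middle hypotheses are provable-now
supports, kept explicit so that the reduction itself can be certified early). -/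
@[route_item "route-Parity-ParityCorner"]
def Assembly : Prop :=
  LeftHalfDiscBound → RightHalfDiscBound → TrivialRegion → CornerContinuation → VitaliPorter → PairsHL

end Summit.Parity.GeneralizedHardyLittlewood.Theses.ParityCorner
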